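import Literature.Probability.FitznerVanDerHofstad2017.SrwIntegralJCone
import HarnessLib

/-!
# `𝓙_{n,l}(x)`: the THRESHOLD-TABLE form of the F-IM sup rule (certificate interface for
`srwJ_le_of_partsTables`; b2b-lace D41 / C22 (ii), LEMMAS N47 `fim_tables`)

CITATION HEADER (PLACEMENT v2). This module is part of a certified REPRODUCTION of:
R. Fitzner, R. van der Hofstad, *Generalized approach to the non-backtracking lace expansion*,
Probab. Theory Related Fields 169 (2017) 1041–1119 [NoBLE17] (cited in the arXiv:1506.07969 numbering)
and *Mean-field behavior for nearest-neighbor percolation in d > 10*, Electron. J. Probab. 22 (2017)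
no. 43 [FvdH17]; and of R. Fitzner's thesis (TU/e 2013), §3.6.  Origin: build `lace` (b2b), seat lean2-g7
(LEAN TYPING SEAT 2), consumer side of LEMMAS node N47 (the two-engine tables of the finite premises of
`SrwIntegralJCone.srwJ_le_of_partsTables`, tail-g3 N46).

## What this file adds (no numerals; generic in `d`, `m`, `l`)

`SrwIntegralJCone.srwJ_le_of_partsTables` reduces the per-cone statement
  `(PC)  𝓙_c(x) ≤ 𝓙_c(v)` for every `x ∈ ℤ^d` whose `|x|` dominates the sorted node `v` coordinatewise
(`𝓙_c = srwJ d m l`, [NoBLE17] (3.30); thesis (3.6.18)–(3.6.19) p. 101–102, `SRW.nb` `IM[n,l,x]`,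
`m = n + 2`) and the shell statement `sup_{‖x‖₁ ≥ s} 𝓙_c = 𝓙_c(argmax node)` to finitely many inequalities
between values of `𝓙_c` / of its cone majorant `B_c = srwJcone d m l` at zero-padded partitions
(`vecOfParts d p`, `p ∈ partsLe r r r`).  A certificate seat delivers those values as INTERVALS; this file
fixes the shape in which such a table enters the kernel, once per cell `c = (m, l)`:

* `JUpper d m l s R T` — for a computable threshold table `T : List ℕ → ℚ`: `𝓙_c(p̂) ≤ T p` for every
  partition `p` of every `r` with `s ≤ r ≤ R`, and `B_c(p̂) ≤ T p` for every partition of `R + 1`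
  (`p̂ = vecOfParts d p`).  An interval engine DISCHARGES it by checking `upper end ≤ T p` row by row.
* `JLower d m l L nodes` — `L v ≤ 𝓙_c(v̂)` for the listed node shapes (`lower end ≥ L v`).
* `srwJ_le_node_of_tables` — (PC) at a node `v` from `JUpper`, `JLower` and ONE decidable side condition
  `PCCheck` on the rational tables (every partition in range is `v` itself, or does not dominate `v`, or
  has `T p ≤ L v`), proved in each instance by `decide +kernel` (the KERNEL evaluates the table look-ups and
  rational comparisons: decimal `ℚ` literals are `@[irreducible]` `Rat.ofScientific` to the elaborator's
  `decide`, transparent to the kernel; standard axioms, no `native_decide` — the `Knauf1998.Kernel*` pattern).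
* `srwJ_le_argmax_of_tables` — the shell statement `‖x‖₁ ≥ s ⇒ 𝓙_c(x) ≤ 𝓙_c(û)` from the same tables and
  the decidable `ShellCheck` (every partition in range is `u`, or has `T p ≤ L u`).

So a cell's certificate is: two short tables of decimals (the thresholds), two named hypotheses, and per
node one `decide +kernel`.  The thresholds are NOT engine outputs but round numbers both engines must dominate
(b2b-lace two-engine rule; AGREE.md §N47); the instances live in `MeanFieldD11FimSup` (d = 11).
Everything here is [folklore] bookkeeping over `SrwIntegralJCone`; no claim about the print is made beyond
that file's header.
-/

namespace Literature.Probability.FitznerVanDerHofstad2017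

open Finset

variable {d : ℕ}

/-! ### Table hypotheses -/

/-- UPPER threshold table for the cell `𝓙 = srwJ d m l`: `𝓙(p̂) ≤ T p` on the sorted shells
`s ≤ ‖p̂‖₁ ≤ R` and `B(p̂) ≤ T p` on the sorted shell `‖p̂‖₁ = R + 1` (`p̂ = vecOfParts d p`). [folklore] -/
def JUpper (d m l s R : ℕ) (T : List ℕ → ℚ) : Prop :=
  (∀ r : ℕ, s ≤ r → r ≤ R → ∀ p ∈ partsLe r r r, srwJ d m l (vecOfParts d p) ≤ ((T p : ℚ) : ℝ)) ∧
  (∀ p ∈ partsLe (R + 1) (R + 1) (R + 1), srwJcone d m l (vecOfParts d p) ≤ ((T p : ℚ) : ℝ))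

/-- A table on the shells `s … R` serves every `s' ≥ s`. [folklore] -/
theorem JUpper.mono {d m l s s' R : ℕ} {T : List ℕ → ℚ} (h : JUpper d m l s R T) (hs : s ≤ s') :
    JUpper d m l s' R T :=
  ⟨fun r hr hrR p hp => h.1 r (hs.trans hr) hrR p hp, h.2⟩

/-- LOWER threshold table for the cell `𝓙 = srwJ d m l` at the node shapes: `L v ≤ 𝓙(v̂)`. [folklore] -/
def JLower (d m l : ℕ) (L : List ℕ → ℚ) (nodes : List (List ℕ)) : Prop :=
  ∀ v ∈ nodes, ((L v : ℚ) : ℝ) ≤ srwJ d m l (vecOfParts d v)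

/-- The decidable side condition of the per-cone rule at node `v`: every partition `p` of every `r`,
`s ≤ r ≤ R + 1`, is the node itself (then `r ≤ R`), or does not dominate `v̂`, or has `T p ≤ lam`. [folklore] -/
def PCCheck (d s R : ℕ) (T : List ℕ → ℚ) (v : List ℕ) (lam : ℚ) : Prop :=
  ∀ r : ℕ, s ≤ r → r ≤ R + 1 → ∀ p ∈ partsLe r r r,
    (p = v ∧ r ≤ R) ∨ (¬ ∀ j : Fin d, vecOfParts d v j ≤ vecOfParts d p j) ∨ T p ≤ lam

/-- `PCCheck` is a bounded conjunction of decidable atoms. [folklore] -/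
instance (d s R : ℕ) (T : List ℕ → ℚ) (v : List ℕ) (lam : ℚ) : Decidable (PCCheck d s R T v lam) := by
  unfold PCCheck; infer_instance

/-- The decidable side condition of the shell rule with argmax node `u`: every partition `p` of every
`r`, `s ≤ r ≤ R + 1`, is `u` itself (then `r ≤ R`) or has `T p ≤ lam`. [folklore] -/
def ShellCheck (s R : ℕ) (T : List ℕ → ℚ) (u : List ℕ) (lam : ℚ) : Prop :=
  ∀ r : ℕ, s ≤ r → r ≤ R + 1 → ∀ p ∈ partsLe r r r, (p = u ∧ r ≤ R) ∨ T p ≤ lam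

/-- `ShellCheck` is a bounded conjunction of decidable atoms. [folklore] -/
instance (s R : ℕ) (T : List ℕ → ℚ) (u : List ℕ) (lam : ℚ) : Decidable (ShellCheck s R T u lam) := by
  unfold ShellCheck; infer_instance

/-- Zero-padded partitions are coordinatewise nonnegative. [folklore] -/
theorem vecOfParts_nonneg (d : ℕ) (p : List ℕ) (j : Fin d) : 0 ≤ vecOfParts d p j := by
  unfold vecOfParts; positivity

/-- The empty partition pads to the zero vector. [folklore] -/
@[simp] theorem vecOfParts_nil (d : ℕ) (j : Fin d) : vecOfParts d [] j = 0 := by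
  simp [vecOfParts]

/-! ### The per-cone rule from tables -/

/-- **(PC) from threshold tables.** For `m ≥ 1`, `d ≥ 2m+3`, a sorted node shape `v` with
`s ≤ ‖v̂‖₁ ≤ R`: if the cell's upper table `T` holds on the shells `s … R` / `R + 1`, `lam ≤ 𝓙(v̂)`, and
`PCCheck` holds (`decide +kernel`), then `𝓙(x) ≤ 𝓙(v̂)` for EVERY `x ∈ ℤ^d` with `|x_j| ≥ v̂_j` (all `j`) —
hence (by `srwJ_spAct`) for every `x` whose sorted `|x|` dominates `v̂`. [folklore] -/
theorem srwJ_le_node_of_tables {m : ℕ} (hm : 1 ≤ m) (hd : 2 * (m + 1) + 1 ≤ d) (l s R : ℕ)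
    (T : List ℕ → ℚ) (hT : JUpper d m l s R T) (v : List ℕ) (lam : ℚ)
    (hlo : ((lam : ℚ) : ℝ) ≤ srwJ d m l (vecOfParts d v))
    (hv : Antitone (vecOfParts d v)) (hsv : (s : ℤ) ≤ ∑ j, vecOfParts d v j)
    (hvR : ∑ j, vecOfParts d v j ≤ R) (hcheck : PCCheck d s R T v lam)
    (x : Fin d → ℤ) (hx : ∀ j, vecOfParts d v j ≤ |x j|) :
    srwJ d m l x ≤ srwJ d m l (vecOfParts d v) := by
  have hxs : (s : ℤ) ≤ ∑ j, |x j| := hsv.trans (Finset.sum_le_sum fun j _ => hx j)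
  refine srwJ_le_of_partsTables hm hd l s R _ (vecOfParts d v) hv (vecOfParts_nonneg d v)
    (by omega) ?_ ?_ x hx hxs
  · intro r hsr hrR p hp hdom
    rcases hcheck r hsr (by omega) p hp with ⟨rfl, -⟩ | hnd | hle
    · exact le_rfl
    · exact absurd hdom hnd
    · exact (hT.1 r hsr hrR p hp).trans ((Rat.cast_le.2 hle).trans hlo)
  · intro p hp hdom
    rcases hcheck (R + 1) (by omega) le_rfl p hp with ⟨-, h⟩ | hnd | hle
    · omega
    · exact absurd hdom hnd
    · exact (hT.2 p hp).trans ((Rat.cast_le.2 hle).trans hlo)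

/-! ### The shell rule from tables -/

/-- **Shell sup from threshold tables.** For `m ≥ 1`, `d ≥ 2m+3`, `s ≤ R + 1` and a shape `u`: if the
cell's upper table holds on the shells `s … R` / `R + 1`, `lam ≤ 𝓙(û)` and `ShellCheck` holds
(`decide +kernel`), then `𝓙(x) ≤ 𝓙(û)` for EVERY `x` with `‖x‖₁ ≥ s`; i.e. `sup_{‖x‖₁ ≥ s} 𝓙 = 𝓙(û)` when
`‖û‖₁ ≥ s` (thesis (3.6.19): the sup "is attained at one of the lowest-order points"). [folklore] -/
theorem srwJ_le_argmax_of_tables {m : ℕ} (hm : 1 ≤ m) (hd : 2 * (m + 1) + 1 ≤ d) (l s R : ℕ)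
    (T : List ℕ → ℚ) (hT : JUpper d m l s R T) (u : List ℕ) (lam : ℚ)
    (hlo : ((lam : ℚ) : ℝ) ≤ srwJ d m l (vecOfParts d u)) (hsR : s ≤ R + 1)
    (hcheck : ShellCheck s R T u lam)
    (x : Fin d → ℤ) (hxs : (s : ℤ) ≤ ∑ j, |x j|) :
    srwJ d m l x ≤ srwJ d m l (vecOfParts d u) := by
  refine srwJ_le_of_partsTables hm hd l s R _ (vecOfParts d []) (fun _ _ _ => by simp)
    (vecOfParts_nonneg d []) (by simp; positivity) ?_ ?_ x (fun j => by simp) hxs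
  · intro r hsr hrR p hp _
    rcases hcheck r hsr (by omega) p hp with ⟨rfl, -⟩ | hle
    · exact le_rfl
    · exact (hT.1 r hsr hrR p hp).trans ((Rat.cast_le.2 hle).trans hlo)
  · intro p hp _
    rcases hcheck (R + 1) hsR le_rfl p hp with ⟨-, h⟩ | hle
    · omega
    · exact (hT.2 p hp).trans ((Rat.cast_le.2 hle).trans hlo)

/-- `‖x‖₁ ≥ 1 ↔ x ≠ 0` repackaging of `srwJ_le_argmax_of_tables` for the `sup_{x ≠ 0}` lists. [folklore] -/
theorem srwJ_le_argmax_of_tables_ne_zero {m : ℕ} (hm : 1 ≤ m) (hd : 2 * (m + 1) + 1 ≤ d) (l R : ℕ)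
    (T : List ℕ → ℚ) (hT : JUpper d m l 1 R T) (u : List ℕ) (lam : ℚ)
    (hlo : ((lam : ℚ) : ℝ) ≤ srwJ d m l (vecOfParts d u)) (hcheck : ShellCheck 1 R T u lam)
    (x : Fin d → ℤ) (hx : x ≠ 0) : srwJ d m l x ≤ srwJ d m l (vecOfParts d u) :=
  srwJ_le_argmax_of_tables hm hd l 1 R T hT u lam hlo (by omega) hcheck x
    ((one_le_sum_abs_iff x).mpr hx)

end Literature.Probability.FitznerVanDerHofstad2017
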